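import Mathlib
import Literature.Analysis.FluidPDE.Tao2016AveragedNS.ShiftSetCascadeFlows
import Literature.Analysis.FluidPDE.Tao2016AveragedNS.ShiftSetCascadeFlux
import Summits.NavierStokesRegularity.NavierStokesRegularity.Theorems.TaoLadderRungTwoFlatCertificateGlueCheckerAssembleOn
import Summits.NavierStokesRegularity.NavierStokesRegularity.Theorems.TaoLadderRungTwoFlatCertificateGlueCheckerRowOn
import Summits.NavierStokesRegularity.NavierStokesRegularity.Theorems.TaoLadderRungTwoFlatCertificateGlueCheckerRegionOn
import Summits.NavierStokesRegularity.NavierStokesRegularity.Theorems.TaoLadderRungTwoFlatCertificateGlueLohnerBoxOn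
import HarnessLib

/-!
# Certificate glue on a shift set `𝕊`, XXVII-b: THE STEP CHECKER WITH A BOX REGION — `StepCert j` from the Boolean tests of one Lohner step
  where the Lipschitz / input-defect region is the WEIGHTED BOX `[lo, hi]·ω` around the Picard tube (glue XIX-g), tested by `checkBoxCovers`,
  `checkLipT`, `checkDefectT`, `checkGronwallK` (glue XXV-h and XXV-i) instead of the `R`-ball tests of glue XXVII
  (helper for items stmt-NavierStokesRegularity-22987 `FlatGapCertificatesV2` (crux K_A♭ of route TaoLadderRungTwoFlat) and stmt-24295 K_A₂(64);
  cell harvest/h2-tao-ladder, p1 g15; theory-1 R9 «box region», bus l.534)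

HONEST FRAMING: Tao-type MODEL lattices (Tao 2016 §4/§6 vocabulary, shift-set parametrised); soundness of a checker — NO certificate instance exists
in the tree, nothing is certified here, no stub is closed, nothing here is a statement about the Navier–Stokes equations.
-/

-- the sub-problem namespace repeats the summit name by design (D-0017)
set_option linter.dupNamespace false

namespace Summit.NavierStokesRegularity.NavierStokesRegularity.Theorems

open Set Finset Literature.Analysis.FluidPDE Literature.Analysis.FluidPDE.TaoCascade
open Summit.NavierStokesRegularity.NavierStokesRegularity.Theorems.TaylorModelCert
open Summit.NavierStokesRegularity.NavierStokesRegularity.Theorems.TaylorModelReadout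

namespace CertificateGlueOn

variable {m : ℕ} {Kb Ka : ℤ}

/-- Coordinates at a window index: `pxcoord q (idxOf i k) = q i k / ω i k`. [folklore] -/
theorem pxcoord_idxOf {ω : Fin m → ℤ → ℝ} (q : Fin m → ℤ → ℝ) (i : Fin m) {k : ℤ} (h : -Kb ≤ k ∧ k ≤ Ka) :
    pxcoord Kb Ka ω q (idxOf Kb Ka i k h) = q i k / ω i k := by
  unfold pxcoord idxOf pwcoord
  rw [Equiv.symm_apply_apply]
  have hk : shellAt Kb (⟨(k + Kb).toNat, by unfold winLen; rw [Int.toNat_lt_toNat (by omega)]; omega⟩ :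
      Fin (winLen Kb Ka)) = k := by
    simp only [shellAt]; rw [Int.toNat_of_nonneg (by omega)]; ring
  simp only [hk]

/-- The array index of the window coordinate `(i, k)` is `(k + Kb) + W·i`. [folklore] -/
theorem idxOf_val (i : Fin m) {k : ℤ} (h : -Kb ≤ k ∧ k ≤ Ka) :
    ((idxOf Kb Ka i k h : Fin (m * winLen Kb Ka)) : ℕ) = (k + Kb).toNat + winLen Kb Ka * i.val := by
  simp [idxOf]

/-- `bRowSum` is nonnegative (a sum of magnitudes). [folklore] -/
theorem bRowSum_nonneg {shifts : List (ℤ × ℤ × ℤ)} (hnd : shifts.Nodup)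
    (coefB : Fin m → ℤ → Fin m → Fin m → ℤ × ℤ × ℤ → IntervalD) (i : Fin m) (k : ℤ) :
    0 ≤ (bRowSum Kb Ka shifts coefB i k).toReal := by
  rw [toReal_bRowSum hnd]
  refine Finset.sum_nonneg fun i₁ _ => Finset.sum_nonneg fun i₂ _ => Finset.sum_nonneg fun μ _ => ?_
  unfold activeMag
  split_ifs
  · simp only [IntervalD.mag, Dyad.toReal_max, Dyad.toReal_abs]; exact le_max_of_le_left (abs_nonneg _)
  · simp

/-- **The box-covering test** (C13): per window coordinate `c = idx(i,k)`, `lo_c ≤ x_c − w` and `x_c + w ≤ hi_c` with the fattened Picard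
half-width `w = ρC + E₀ + h·bRowSum_{(i,k)}·R_h² + A'`, `R_h = (mC + ρC + E₀)/(1 − b(mC + ρC + E₀)h)` the majorant radius. [folklore] -/
def checkBoxCovers (m : ℕ) (Kb Ka : ℤ) (shifts : List (ℤ × ℤ × ℤ)) (coefB : Fin m → ℤ → Fin m → Fin m → ℤ × ℤ × ℤ → IntervalD)
    (xD loD hiD : Array Dyad) (b mC ρC E₀ h A' : ℚ) : Bool :=
  let Rh : ℚ := (mC + (ρC + E₀)) / (1 - b * (mC + (ρC + E₀)) * h)
  (List.finRange m).all fun i => (List.range (winLen Kb Ka)).all fun cc =>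
    decide (dyadToRat (dgetD loD (cc + winLen Kb Ka * i.val)) ≤ dyadToRat (dgetD xD (cc + winLen Kb Ka * i.val)) -
        (ρC + E₀ + h * (dyadToRat (bRowSum Kb Ka shifts coefB i ((cc : ℤ) - Kb)) * Rh ^ 2) + A')) &&
    decide (dyadToRat (dgetD xD (cc + winLen Kb Ka * i.val)) +
        (ρC + E₀ + h * (dyadToRat (bRowSum Kb Ka shifts coefB i ((cc : ℤ) - Kb)) * Rh ^ 2) + A') ≤
        dyadToRat (dgetD hiD (cc + winLen Kb Ka * i.val)))

/-- **Soundness of the box-covering test**: every state within `A'·ω` of a state in the Picard tube (at any `u ≤ h`) lies in the weighted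
box `[wbox lo, wbox hi]` — the hypothesis `hG` of glue XIX-g. [folklore] -/
theorem inBox_of_checkBoxCovers {shifts : List (ℤ × ℤ × ℤ)} (hnd : shifts.Nodup)
    {coefB : Fin m → ℤ → Fin m → Fin m → ℤ × ℤ × ℤ → IntervalD}
    {ωq : Fin m → ℤ → ℚ} (hω : ∀ i k, 0 < ωq i k) {xD loD hiD : Array Dyad} {b mC ρC E₀ h A' : ℚ}
    (hc : checkBoxCovers m Kb Ka shifts coefB xD loD hiD b mC ρC E₀ h A' = true) {u : ℝ} (hu : u ∈ Icc (0 : ℝ) (h : ℝ))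
    {q y : Fin m → ℤ → ℝ}
    (hq : PicardTube Kb Ka (fun i k => (ωq i k : ℝ)) (dvec (n := m * winLen Kb Ka) xD)
      (fun d => (bRowSum Kb Ka shifts coefB (finProdFinEquiv.symm d).1 (shellAt Kb (finProdFinEquiv.symm d).2)).toReal)
      (ρC : ℝ) (E₀ : ℝ) (((mC : ℝ) + ((ρC : ℝ) + (E₀ : ℝ))) / (1 - (b : ℝ) * ((mC : ℝ) + ((ρC : ℝ) + (E₀ : ℝ))) * (h : ℝ))) u q)
    (hnear : ∀ i k, -Kb ≤ k → k ≤ Ka → |y i k - q i k| ≤ (A' : ℝ) * (ωq i k : ℝ)) :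
    InBoxOn Kb Ka (wbox Kb Ka (fun i k => (ωq i k : ℝ)) loD) (wbox Kb Ka (fun i k => (ωq i k : ℝ)) hiD) y := by
  intro i k hk1 hk2
  have hw : -Kb ≤ k ∧ k ≤ Ka := ⟨hk1, hk2⟩
  simp only [checkBoxCovers, List.all_eq_true, List.mem_finRange, List.mem_range, Bool.and_eq_true, decide_eq_true_eq,
    true_implies] at hc
  have hcc : (k + Kb).toNat < winLen Kb Ka := by
    unfold winLen; rw [Int.toNat_lt_toNat (by omega)]; omega
  obtain ⟨h1, h2⟩ := hc i (k + Kb).toNat hcc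
  rw [Int.toNat_of_nonneg (by omega), show k + Kb - Kb = k by ring] at h1 h2
  have hidx := idxOf_val (Kb := Kb) (Ka := Ka) i hw
  -- the Picard bound at the coordinate `c = idx(i,k)`
  have hpc := hq (idxOf Kb Ka i k hw)
  rw [pxcoord_idxOf q i hw] at hpc
  have hsymm : finProdFinEquiv.symm (idxOf Kb Ka i k hw) = (i, ⟨(k + Kb).toNat, hcc⟩) := by
    unfold idxOf; rw [Equiv.symm_apply_apply]
  have hsh : shellAt Kb (⟨(k + Kb).toNat, hcc⟩ : Fin (winLen Kb Ka)) = k := by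
    simp only [shellAt]; rw [Int.toNat_of_nonneg (by omega)]; ring
  simp only [hsymm, hsh, dvec, hidx] at hpc
  -- names
  have hωk : (0 : ℝ) < (ωq i k : ℝ) := by exact_mod_cast hω i k
  set W : ℝ := (ωq i k : ℝ) with hW
  set B : ℝ := (bRowSum Kb Ka shifts coefB i k).toReal with hB
  set X : ℝ := (dgetD xD ((k + Kb).toNat + winLen Kb Ka * i.val)).toReal with hX
  set L : ℝ := (dgetD loD ((k + Kb).toNat + winLen Kb Ka * i.val)).toReal with hL
  set U : ℝ := (dgetD hiD ((k + Kb).toNat + winLen Kb Ka * i.val)).toReal with hU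
  set Rh : ℝ := ((mC : ℝ) + ((ρC : ℝ) + (E₀ : ℝ))) / (1 - (b : ℝ) * ((mC : ℝ) + ((ρC : ℝ) + (E₀ : ℝ))) * (h : ℝ)) with hRh
  have hB0 : 0 ≤ B := bRowSum_nonneg hnd coefB i k
  -- the two rational inequalities, in `ℝ`
  have h1r : L ≤ X - ((ρC : ℝ) + (E₀ : ℝ) + (h : ℝ) * (B * Rh ^ 2) + (A' : ℝ)) := by
    have := (Rat.cast_le (K := ℝ)).mpr h1
    simp only [Rat.cast_sub, Rat.cast_add, Rat.cast_mul, Rat.cast_pow, Rat.cast_div, Rat.cast_one, cast_dyadToRat] at this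
    exact this
  have h2r : X + ((ρC : ℝ) + (E₀ : ℝ) + (h : ℝ) * (B * Rh ^ 2) + (A' : ℝ)) ≤ U := by
    have := (Rat.cast_le (K := ℝ)).mpr h2
    simp only [Rat.cast_sub, Rat.cast_add, Rat.cast_mul, Rat.cast_pow, Rat.cast_div, Rat.cast_one, cast_dyadToRat] at this
    exact this
  -- the Picard bound at time `u ≤ h`
  have hP : |q i k / W - X| ≤ (ρC : ℝ) + (E₀ : ℝ) + (h : ℝ) * (B * Rh ^ 2) :=
    hpc.trans (by nlinarith [mul_nonneg hB0 (sq_nonneg Rh), hu.2])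
  have hqW : q i k = W * (q i k / W) := by field_simp
  have hn := hnear i k hk1 hk2
  rw [abs_le] at hP hn
  -- the weighted box at `(i,k)`
  have hlo : wbox Kb Ka (fun i k => (ωq i k : ℝ)) loD i k = W * L := by
    unfold wbox; rw [dif_pos hw, hidx]
  have hhi : wbox Kb Ka (fun i k => (ωq i k : ℝ)) hiD i k = W * U := by
    unfold wbox; rw [dif_pos hw, hidx]
  rw [hlo, hhi]
  constructor
  · have : W * L ≤ W * (q i k / W) - (A' : ℝ) * W := by
      have := mul_le_mul_of_nonneg_left h1r hωk.le
      nlinarith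
    linarith [hqW]
  · have : W * (q i k / W) + (A' : ℝ) * W ≤ W * U := by
      have := mul_le_mul_of_nonneg_left h2r hωk.le
      nlinarith
    linarith [hqW]

/-- `0 ≤ K` and `0 ≤ δ` from the Grönwall test. [folklore] -/
theorem nonneg_of_checkGronwallK {K δ h A : ℚ} {k n : ℕ} (hc : checkGronwallK K δ h A k n = true) :
    (0 : ℝ) ≤ (K : ℝ) ∧ (0 : ℝ) ≤ (δ : ℝ) := by
  simp only [checkGronwallK, Bool.and_eq_true, decide_eq_true_eq] at hc
  obtain ⟨⟨⟨⟨⟨hK, hδ⟩, -⟩, -⟩, -⟩, -⟩ := hc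
  exact ⟨by exact_mod_cast hK.le, by exact_mod_cast hδ⟩

/-- **THE STEP CHECKER WITH A BOX REGION IS SOUND**: if all Boolean tests of one Lohner step pass — the (B)-table (C1), centre (C2), frame rows
(C3), Taylor landing (C4), variational norm (C5), frame (C6), defect absorption (C7), error recursion (C8), guard (C9), and, on the WEIGHTED BOX
`[lo, hi]·ω`: box covering (C13), K-table (`checkLipT`), input-defect table (`checkDefectT`), Grönwall allowance (`checkGronwallK`) — then
the step is a `StepCert j` for the node/hull predicates read off the data (node `j` = the input parallelepiped with slack `E₀`, node `j+1` = the
output parallelepiped with slack `E₁ + A`, hull `j` ⊇ the dense tube meet the Picard tube, fattened by `A·ω`). Glue XIX-g with every analytic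
hypothesis discharged by glue XXIV–XXVI and XXV-h and XXV-i.
[cite: Zgliczynski2002C1Lohner, §3–4 (Lohner-type parallelepiped frames and the C¹/variational enclosure); cell certificate format, Lohner step, box region] -/
theorem stepCert_of_checks_box (hKb : 0 ≤ Kb) (hKa : 1 ≤ Ka) {shifts : List (ℤ × ℤ × ℤ)} (hnd : shifts.Nodup)
    (h𝕊 : IsNearestNeighbourSet shifts.toFinset) {q : ℚ} (hq : 0 < 1 + (q : ℝ))
    {αq : Fin m → Fin m → Fin m → ℤ × ℤ × ℤ → ℚ} {ωq : Fin m → ℤ → ℚ} (hω : ∀ i k, 0 < ωq i k)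
    {prec p kexp nexp : ℕ} {Sp Sm : IntervalD} (hSp : sqrtCheck prec (1 + q) Sp = true)
    (hSm : sqrtCheck prec (1 / (1 + q)) Sm = true)
    {M : ℤ → ℝ} {t : ℕ → ℝ} {Node Hull : ℕ → (Fin m → ℤ → ℝ) → Prop} {j : ℕ}
    {xD x'D rD r'D loD hiD : Array Dyad} {C Cn Cin : Array (Array Dyad)} {bD mC ρC dP NVh κI δD : Dyad}
    {K A A' Eb Et E₀ E₁ h : ℚ}
    -- data signs and the step length
    (hb : 0 ≤ bD.toReal) (hmC : 0 ≤ mC.toReal) (hρC : 0 ≤ ρC.toReal) (hE₀ : (0 : ℚ) ≤ E₀)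
    (hAA' : A < A') (ht : t (j + 1) - t j = (h : ℝ))
    -- the tests
    (hchkB : checkB m Kb Ka shifts (coefBoxOf prec αq ωq Sp Sm) bD = true)
    (h2 : checkAbsLe (m * winLen Kb Ka) xD mC = true)
    (h3 : checkRowSum (m * winLen Kb Ka) C rD ρC = true)
    (h4 : checkTPoly (m * winLen Kb Ka) prec
      (IntervalD.polyLevelsA (m * winLen Kb Ka) prec
        (IntervalD.jetLevelsA (m * winLen Kb Ka) (pqBoxA Kb Ka prec shifts (coefBoxOf prec αq ωq Sp Sm)) prec
          (pointBoxA (m * winLen Kb Ka) xD) p) p (ofRatRel prec h)) x'D dP = true)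
    (h5 : checkNVh (m * winLen Kb Ka)
      (IntervalD.polyLevelsA (m * winLen Kb Ka) prec
        (IntervalD.varJetLevelsA (m * winLen Kb Ka) (pqBoxA Kb Ka prec shifts (coefBoxOf prec αq ωq Sp Sm)) prec
          (IntervalD.jetLevelsA (m * winLen Kb Ka) (pqBoxA Kb Ka prec shifts (coefBoxOf prec αq ωq Sp Sm)) prec
            (pointBoxA (m * winLen Kb Ka) xD) p)
          (unitBoxA (m * winLen Kb Ka)) p) p (ofRatRel prec h)) NVh = true)
    (h6 : checkFrame (m * winLen Kb Ka)
      (pcolsA prec (m * winLen Kb Ka) Cin (vcolsA Kb Ka prec shifts (coefBoxOf prec αq ωq Sp Sm) p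
        (IntervalD.jetLevelsA (m * winLen Kb Ka) (pqBoxA Kb Ka prec shifts (coefBoxOf prec αq ωq Sp Sm)) prec
          (pointBoxA (m * winLen Kb Ka) xD) p) (ofRatRel prec h) C)) rD r'D = true)
    (h7 : checkKappa prec (m * winLen Kb Ka) Cn
      (pcolsA prec (m * winLen Kb Ka) Cin (vcolsA Kb Ka prec shifts (coefBoxOf prec αq ωq Sp Sm) p
        (IntervalD.jetLevelsA (m * winLen Kb Ka) (pqBoxA Kb Ka prec shifts (coefBoxOf prec αq ωq Sp Sm)) prec
          (pointBoxA (m * winLen Kb Ka) xD) p) (ofRatRel prec h) C))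
      (vcolsA Kb Ka prec shifts (coefBoxOf prec αq ωq Sp Sm) p
        (IntervalD.jetLevelsA (m * winLen Kb Ka) (pqBoxA Kb Ka prec shifts (coefBoxOf prec αq ωq Sp Sm)) prec
          (pointBoxA (m * winLen Kb Ka) xD) p) (ofRatRel prec h) C) rD κI = true)
    (h8 : checkERec p (dyadToRat bD) (dyadToRat mC) (dyadToRat ρC) E₀ (dyadToRat κI) (dyadToRat dP) (dyadToRat NVh) h E₁
      = true)
    (h9 : checkGuard (dyadToRat bD) (dyadToRat mC) (dyadToRat ρC) E₀ h = true)
    -- the box-region tests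
    (h13 : checkBoxCovers m Kb Ka shifts (coefBoxOf prec αq ωq Sp Sm) xD loD hiD (dyadToRat bD) (dyadToRat mC) (dyadToRat ρC)
      E₀ h A' = true)
    (h10 : checkLipT m Kb Ka shifts (coefBoxOf prec αq ωq Sp Sm) loD hiD K = true)
    (h11 : checkDefectT m Kb Ka prec shifts αq ωq Eb Et loD hiD Sp Sm δD = true)
    (h12 : checkGronwallK K (dyadToRat δD) h A kexp nexp = true)
    -- the node / hull inclusions (definitional for the chain builder)
    (hN : ∀ y, Node j y → PInPara Kb Ka (fun i k => (ωq i k : ℝ)) (dvec (n := m * winLen Kb Ka) xD)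
      (dmat (n := m * winLen Kb Ka) C) (dvec (n := m * winLen Kb Ka) rD) (E₀ : ℝ) y)
    (hH : ∀ u ∈ Icc 0 (h : ℝ), ∀ y q' : Fin m → ℤ → ℝ,
      TubeL shifts.toFinset (q : ℝ) (fun i₁ i₂ i μ => (αq i₁ i₂ i μ : ℝ)) Kb Ka (fun i k => (ωq i k : ℝ)) p bD.toReal mC.toReal
        ρC.toReal (E₀ : ℝ) ((mC.toReal + (ρC.toReal + (E₀ : ℝ))) / (1 - bD.toReal * (mC.toReal + (ρC.toReal + (E₀ : ℝ))) * (h : ℝ)))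
        (dvec (n := m * winLen Kb Ka) xD) (dmat (n := m * winLen Kb Ka) C) (dvec (n := m * winLen Kb Ka) rD) u q' →
      PicardTube Kb Ka (fun i k => (ωq i k : ℝ)) (dvec (n := m * winLen Kb Ka) xD)
        (fun d => (bRowSum Kb Ka shifts (coefBoxOf prec αq ωq Sp Sm) (finProdFinEquiv.symm d).1
          (shellAt Kb (finProdFinEquiv.symm d).2)).toReal)
        ρC.toReal (E₀ : ℝ) ((mC.toReal + (ρC.toReal + (E₀ : ℝ))) / (1 - bD.toReal * (mC.toReal + (ρC.toReal + (E₀ : ℝ))) * (h : ℝ)))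
        u q' →
      (∀ i k, -Kb ≤ k → k ≤ Ka → |y i k - q' i k| ≤ (A : ℝ) * (ωq i k : ℝ)) → Hull j y)
    (hN' : ∀ y, PInPara Kb Ka (fun i k => (ωq i k : ℝ)) (dvec (n := m * winLen Kb Ka) x'D)
      (dmat (n := m * winLen Kb Ka) Cn) (dvec (n := m * winLen Kb Ka) r'D) ((E₁ : ℝ) + (A : ℝ)) y → Node (j + 1) y) :
    StepCert shifts.toFinset (q : ℝ) (fun i₁ i₂ i μ => (αq i₁ i₂ i μ : ℝ)) Kb Ka (Eb : ℝ) (Et : ℝ) M t Node Hull j := by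
  have hcoef := coefBoxOK_coefBoxOf (Kb := Kb) (Ka := Ka) prec hq αq ωq hSp hSm shifts
  have hω' : ∀ i k, (0 : ℝ) < (ωq i k : ℝ) := fun i k => by exact_mod_cast hω i k
  have hX : (pointBoxA (m * winLen Kb Ka) xD).size = m * winLen Kb Ka := by simp [pointBoxA]
  have hx := mem_pointBoxA (m * winLen Kb Ka) xD
  have hhmem : IntervalD.mem ((h : ℚ) : ℝ) (ofRatRel prec h) := mem_ofRatRel prec h
  -- scalar tests, casts bridged
  have hg := guard_of_check h9
  have hgr := gronwallK_of_check h12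
  have hKδ := nonneg_of_checkGronwallK h12
  simp only [cast_dyadToRat] at hg hgr hKδ
  have hcl := landingClauses_of_checks (ω := fun i k => (ωq i k : ℝ)) (ε₀ := (q : ℝ))
    (α := fun i₁ i₂ i μ => (αq i₁ i₂ i μ : ℝ)) hKb hKa hnd hcoef p hX hx hhmem h4 h5 h6 h7 h8
  simp only [cast_dyadToRat] at hcl
  have hAA'r : (A : ℝ) < (A' : ℝ) := by exact_mod_cast hAA'
  -- the box region
  have hG : ∀ u ∈ Icc 0 (t (j + 1) - t j), ∀ q' y : Fin m → ℤ → ℝ,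
      PicardTube Kb Ka (fun i k => (ωq i k : ℝ)) (dvec (n := m * winLen Kb Ka) xD)
        (fun d => (bRowSum Kb Ka shifts (coefBoxOf prec αq ωq Sp Sm) (finProdFinEquiv.symm d).1
          (shellAt Kb (finProdFinEquiv.symm d).2)).toReal)
        ρC.toReal (E₀ : ℝ) ((mC.toReal + (ρC.toReal + (E₀ : ℝ))) / (1 - bD.toReal * (mC.toReal + (ρC.toReal + (E₀ : ℝ))) *
          (t (j + 1) - t j))) u q' →
      (∀ i k, -Kb ≤ k → k ≤ Ka → |y i k - q' i k| ≤ (A' : ℝ) * (ωq i k : ℝ)) →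
      InBoxOn Kb Ka (wbox Kb Ka (fun i k => (ωq i k : ℝ)) loD) (wbox Kb Ka (fun i k => (ωq i k : ℝ)) hiD) y := by
    intro u hu q' y hq' hnear
    have key := inBox_of_checkBoxCovers (Kb := Kb) (Ka := Ka) hnd hω h13 (u := u) (q := q') (y := y) (by rwa [ht] at hu)
    simp only [cast_dyadToRat] at key
    rw [ht] at hq'
    exact key hq' hnear
  refine stepCert_of_plohner_box (ω := fun i k => (ωq i k : ℝ)) hKb hKa hq hω' hb hmC hρC (by exact_mod_cast hE₀) hKδ.1 hKδ.2
    hAA'r (by rw [ht]; exact hg.1) (by rw [ht]; exact hg.2) (hB_of_checkB hKb hKa hω' hq hnd hcoef hchkB)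
    (hBrow_of_coefBox hKb hKa hω' hq hnd hcoef)
    (abs_le_of_checkAbsLe h2) (mulVec_le_of_checkRowSum h3) (by rw [ht]; exact hcl) hG
    (pfieldLip_of_checkLipT hKb hKa hω' hq hcoef h10)
    (pinputDefect_of_checkDefectT prec hnd h𝕊 hq hω hSp hSm h11) (by rw [ht]; exact hgr) hN
    (fun u hu y q' hq' hpic hnear => hH u (by rwa [ht] at hu) y q' (by rwa [ht] at hq') (by rwa [ht] at hpic) hnear) hN'

end CertificateGlueOn

end Summit.NavierStokesRegularity.NavierStokesRegularity.Theorems
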